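import Literature.MathematicalPhysics.QuantumFieldTheory.Balaban1983to89.B9Thm313WholeZ
import Literature.MathematicalPhysics.QuantumFieldTheory.Balaban1983to89.B9Thm313WholeRgdFrom3152

/-!
# `Balaban1983to89.B9Thm313WholeEntry2HolderCut` — [B9] Theorem 3.13 (p. 426), THE (3.42)₃ ENTRY 𝔊∇*_U OF 𝔊 WITHOUT THE LETTER
# `Letters313Z.rgd1`: the middle term of (3.153) re-cut by the SECOND identity of (3.152), G₁DR = DG′R, at a free intermediate class of
# G₁∇*_U (print's sup ⊕ Hölder species) instead of at the pure sup class W⁰ of RD*G₁∇*_U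

T. Bałaban, *Propagators for lattice gauge theories in a background field*, Commun. Math. Phys. **99** (1985) 389–434
[`Balaban1985BackgroundPropagators`, "B9"]; [4] = T. Bałaban, *Propagators and renormalization transformations for lattice gauge
theories. II*, Commun. Math. Phys. **96** (1984) 223–250 [`Balaban1984PropagatorsII`].

statement-level skeleton of published theorems with citation tags; proofs where landed; nothing here is a claim about the Yang–Mills
mass gap

THE PRINTED LOCUS (held text `paper:balaban1985-cmp99-background-propagators`).  p. 426, (3.152): *"RD\*G₁ = RG′D\*, and G₁DR = DG′R"*;
(3.153): *"𝔊 = G₁ − G₁DRD\*G₁ − G₁Q\*(QG₁Q\*)⁻¹QG₁ = G₁𝔓\* = 𝔓G₁"*; *"The formulas (3.147), (3.153) permit us to reduce properties of the operators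
𝔓, 𝔊 to the corresponding properties of the operators G′, (Q′G′²Q′\*)⁻¹, G₁, (QG₁Q\*)⁻¹"*; Theorem 3.13 p. 426 (Theorem 3.3 for 𝔊, hence
(3.42)₃ |(𝔊∇\*_Uμ)(x)| ≦ B·Lʲη·e^{−δd(y,y′)}|μ|); p. 398: the mixed sup entry |(∇_UG′∇\*_Uλ)(x)| is (3.44), whose right side carries the HÖLDER
norm ‖λ‖_ε of the input (B′₀(ε) → ∞ as ε → 0) — typed `B9.KernelFamily.e4` ∕ `B9.Ineq343_345`; (3.43) p. 398 (‖ζG∇\*_Uλ‖_β ≦ B₀(β)(Lʲη)^{1−β}…|λ|).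

THE POINT (cell `pub/ym-inputs` seat p04, LOCATE memo `LETTERS-313-LOCATE-p04.md` §2 (L1); dag-n06-l g17 «sup R-letters = CZ endpoint»).
`B9Thm313WholeZ.GG_entry2_of_lettersZ` obtains the (3.42)₃ entry of 𝔊 from (3.153) with the middle term G₁DRD\*G₁∇\*_U cut as
(G₁D : W⁰ → 𝔠⁽¹⁾) ∘ (RD\*G₁∇\*_U : Y⁰ → W⁰), i.e. through the letter `Letters313Z.rgd1` — a MIXED second-order entry between PURE sharp-block sup
classes, which is not among print's species ((3.44) needs a Hölder norm of the input) and has no member-uniform supplier at genuine operators.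
Print's own reduction needs no such letter: by the second identity of (3.152) the middle term is
  G₁DRD\*G₁∇\*_U = (G₁DR)(D\*G₁∇\*_U) = (DG′R)(D\*G₁∇\*_U) = (D·G′·R·D\*) ∘ (G₁∇\*_U),
a SITE-sector word of order 0 applied to t := G₁∇\*_Uμ, and print controls t in sup ⊕ Hölder ((3.42)₃ + (3.43) for G₁, Theorem 3.12) and the
word D·G′·R·D\* on such inputs ((3.44) for G′ with its Hölder term, R = ϱ(I − P) with (3.49)).  THIS FILE types that re-cut over the abstract
letter record, with the intermediate class FREE (`bXH : BlockNorm … (X → ℝ)`, the device of `Letters313DZ`'s `bH`):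
* §1 `GG_comp_Dstar_eq_3152` — (3.153) composed with a right factor, middle term rewritten by `Ids3152.dr` (pure algebra);
* §2 ★★ `GG_entry2_holderCut_of_letters` — the (3.42)₃ entry of 𝔊 in the shape of `GG_entry2_of_lettersZ` (two-space sup
  majorant C·Lʲη·e^{−ρ′d}, ρ′ + 3σ ≦ ρ ≦ min(δ₀, δ₃), ρ + σ ≦ δ_K, θc < 1) from: Theorem 3.3 (3.42)₃ for G₀ (`he2`), the step K′₁ on 𝔠⁽¹⁾ (`hK`),
  `Identities`, `Ids3152`, the three `Letters313Z` fields `gQs1 ∕ c1_1 ∕ q1` VERBATIM (so the certificate's `hletters13` projections feed them),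
  and TWO letters of printed species replacing `rgd1` (and `gD1`, unused here): `hXH` — G₁∇\*_U : Y⁰ → `bXH` (B_X·e^{−δ₃d}); `hW` — D·G′·R·D\* :
  `bXH` → 𝔠⁽¹⁾ (B_W·e^{−δ₃d}).  Constant C = A₁ + κ_{XH}·B_W·B_X·c + A₃·(B₃·(B₃·A₁·c)·c)·c with A₁ = B₀(1−θc)⁻¹, A₃ = B₃(1−θc)⁻¹ (as `hasMaj_frakG_classes` delivers it).

HONEST SCOPE.  Kernel bookkeeping over landed schemas (`hasMaj_frakG_classes`, `hasMaj_right_of_step(_weight)`, `GG_comp_eq`): the displayed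
letter `rgd1` is REPLACED by two hypotheses of printed species, not discharged; nothing of [B9]'s estimates is asserted; COUNT-NEUTRAL; N06 NOT
discharged; whether the N06 certificate ∕ the T³ row `hletters` adopt this cut is their owners' call (dag-n06-d ∕ dag-n06-l; ★★OWNER ym3-torus-plan).
One finite lattice at a time; nothing continuum, nothing about the mass gap ∕ Clay.  Seat `ym-inputs-p04` (prover-ym-inputs-p04-0), 2026-08-28; NEW file.
-/

namespace Literature.MathematicalPhysics.QuantumFieldTheory.Balaban1983to89.B9Thm313WholeEntry2HolderCut

open Literature.MathematicalPhysics.QuantumFieldTheory.Balaban1983to89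
open Finset Filter B6RandomWalk B6RandomWalkHom B9Thm34Ext B9Thm37GlueCor36 B11SectG B9SectDSup
open B9Thm37AllNorms B9Thm37AllNormsInstances B9FromB6 B9FromB6ModelSignsOn B9SectBStepWhole B9Thm312Whole B9Thm312WholeLeaf B9Thm313Whole
open B9Thm313WholeZ B9Thm313WholeRgdFrom3152

noncomputable section

section OneMember

variable {g : B9.Geometry} {B : B9.Backgrounds} {X Y Z W : Type}
variable [Fintype X] [Fintype Y] [Fintype Z] [Fintype W] [Fintype g.Site]

/-! ## §1 (3.153) with a right factor, middle term through (3.152) -/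

omit [Fintype Y] [Fintype g.Site] in
/-- **(3.153) COMPOSED WITH A RIGHT FACTOR 𝒳, MIDDLE TERM BY (3.152)**: 𝔊𝒳 = G₁𝒳 − (D·G′·R·D\*)(G₁𝒳) − (G₁Q\*)((QG₁Q\*)⁻¹(Q(G₁𝒳))) — from
𝔊 = G₁𝔓\* (`Identities.eq153`, `B9Thm313Whole.GG_comp_eq`) and G₁DR = DG′R (`Ids3152.dr`): (G₁D)(RD\*G₁𝒳) = (G₁DR)(D\*G₁𝒳) = (DG′R)(D\*G₁𝒳).
[cite: Balaban1985BackgroundPropagators, (3.152)–(3.153) p.426] -/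
theorem GG_comp_Dstar_eq_3152 {V : Type} {𝔬 : Ops g B X Y Z W} {Gp : B.Cfg → Module.End ℝ (W → ℝ)} {U : B.Cfg}
    (hI : Identities 𝔬 U) (h152 : Ids3152 𝔬 Gp U) (Fop : (V → ℝ) →ₗ[ℝ] (X → ℝ)) :
    𝔬.GG U ∘ₗ Fop = 𝔬.G1 U ∘ₗ Fop - (𝔬.Dv U ∘ₗ Gp U ∘ₗ 𝔬.R U ∘ₗ 𝔬.Dvstar U) ∘ₗ (𝔬.G1 U ∘ₗ Fop) -
      (𝔬.G1 U ∘ₗ 𝔬.Qstar U) ∘ₗ (𝔬.C1 U ∘ₗ (𝔬.Q U ∘ₗ (𝔬.G1 U ∘ₗ Fop))) := by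
  have hmid : (𝔬.G1 U ∘ₗ 𝔬.Dv U) ∘ₗ (𝔬.R U ∘ₗ 𝔬.Dvstar U ∘ₗ 𝔬.G1 U ∘ₗ Fop) =
      (𝔬.Dv U ∘ₗ Gp U ∘ₗ 𝔬.R U ∘ₗ 𝔬.Dvstar U) ∘ₗ (𝔬.G1 U ∘ₗ Fop) := by
    refine LinearMap.ext fun v => ?_
    simp only [LinearMap.comp_apply]
    exact h152.dr_apply _
  rw [GG_comp_eq hI Fop, hmid]

/-! ## §2 One member, one U: the sup entry (3.42)₃ of 𝔊 with the middle term cut at a free class of G₁∇*_U -/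

/-- ★★ **THEOREM 3.13, ENTRY (3.42)₃ FOR 𝔊 — MIDDLE TERM CUT AT A FREE CLASS OF G₁∇\*_U, NO LETTER `rgd1`** (statement shape of
`B9Thm313WholeZ.GG_entry2_of_lettersZ`): from Theorem 3.3 (3.42)₃ for G₀ (`he2`, B₀Lʲη·e^{−δ₀d}), the step K′₁ = G₀(Δ′_π + Δ⁽²⁾_π) on 𝔠⁽¹⁾
(`hK`, θe^{−δ_Kd}, θc < 1), the resolvent identity of (3.138) (`Identities`), the identity G₁DR = DG′R (`Ids3152`), the `Letters313Z` fields
`gQs1` (G₀Q\* : Z_{len·w} → 𝔠⁽¹⁾), `c1_1` ((QG₁Q\*)⁻¹ : Z¹ → Z_{len·w}), `q1` (Q : 𝔠⁽¹⁾ → Z¹), and — IN PLACE OF the pure-sup mixed letter `rgd1` —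
the letters `hXH` (G₁∇\*_U : Y⁰ → `bXH`, B_X·e^{−δ₃d}; print's (3.42)₃ ⊕ (3.43) species for G₁) and `hW` (D·G′·R·D\* : `bXH` → 𝔠⁽¹⁾, B_W·e^{−δ₃d};
print's (3.44) species for G′ with (3.49) for R): |(𝔊∇\*_Uμ)(x)| ≦ C·Lʲη·e^{−ρ′d(y,y′)}|μ| for x ∈ Δ(y), supp μ ⊂ Δ(y′), with
C = A₁ + κ_{XH}B_WB_Xc + A₃(B₃(B₃A₁c)c)c (A₁ = B₀(1−θc)⁻¹, A₃ = B₃(1−θc)⁻¹) and every ρ′ ≧ 0 with ρ′ + 3σ ≦ ρ (ρ ≦ δ₀, ρ ≦ δ₃, ρ + σ ≦ δ_K).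
[cite: Balaban1985BackgroundPropagators, Thm 3.13 p.426 + (3.152)–(3.153) p.426 + (3.138) p.423 + (3.42)–(3.44) pp.397–398; Balaban1984PropagatorsII, (2.52)–(2.56) pp.232–233 + Lemma 2.1 (2.61) p.234] -/
theorem GG_entry2_holderCut_of_letters {R₀ : ℝ} {H₀ : Prop} (hG : GeoOK g) {𝔬 : Ops g B X Y Z W} {U : B.Cfg}
    {Gp : B.Cfg → Module.End ℝ (W → ℝ)} {bXH : BlockNorm (toB6 g R₀ H₀) (X → ℝ)}
    {θ B₀ B₃ BW BX δ₀ δ₃ δK ρ ρ' σ c : ℝ} (hrow : RowSum (toB6 g R₀ H₀) σ c) (hc : 0 ≤ c)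
    (hθ : 0 ≤ θ) (hB₀ : 0 ≤ B₀) (hB₃ : 0 ≤ B₃) (hBW : 0 ≤ BW) (hBX : 0 ≤ BX) (hσ : 0 ≤ σ) (hρ' : 0 ≤ ρ')
    (hρ'ρ : ρ' + 3 * σ ≤ ρ) (hρS : ρ ≤ δ₀) (hρ₃ : ρ ≤ δ₃) (hρδ : ρ + σ ≤ δK) (hq : θ * c < 1)
    (hK : HasMaj (cNorm R₀ H₀ 𝔬.blk hG.lenle 1) (cNorm R₀ H₀ 𝔬.blk hG.lenle 1) (𝔬.G0 U ∘ₗ (𝔬.Tpi U + 𝔬.T2 U))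
      (fun a b => θ * Real.exp (-(δK * g.dist a b))))
    (he2 : HasMajorantHom (g := toB6 g R₀ H₀) 𝔬.blkY 𝔬.blk (𝔬.G0 U ∘ₗ 𝔬.Dstar U)
      (fun a b => B₀ * g.len a * Real.exp (-(δ₀ * g.dist a b))))
    {wZ : g.Site → ℝ} {hwZ : ∀ y, 0 < wZ y}
    (hgQs1 : HasMaj (weightNorm (BlockNorm.ofBlocks (toB6 g R₀ H₀) 𝔬.blkZ) (fun y => g.len y * wZ y) fun y => (wZlen_pos hG hwZ y).le)
      (cNorm R₀ H₀ 𝔬.blk hG.lenle 1) (𝔬.G0 U ∘ₗ 𝔬.Qstar U) (fun a b => B₃ * Real.exp (-(δ₃ * g.dist a b))))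
    (hc1_1 : HasMaj (cNorm R₀ H₀ 𝔬.blkZ hG.lenle 1)
      (weightNorm (BlockNorm.ofBlocks (toB6 g R₀ H₀) 𝔬.blkZ) (fun y => g.len y * wZ y) fun y => (wZlen_pos hG hwZ y).le) (𝔬.C1 U)
      (fun a b => B₃ * Real.exp (-(δ₃ * g.dist a b))))
    (hq1 : HasMaj (cNorm R₀ H₀ 𝔬.blk hG.lenle 1) (cNorm R₀ H₀ 𝔬.blkZ hG.lenle 1) (𝔬.Q U)
      (fun a b => B₃ * Real.exp (-(δ₃ * g.dist a b))))
    (hXH : HasMaj (cNorm R₀ H₀ 𝔬.blkY hG.lenle 0) bXH (𝔬.G1 U ∘ₗ 𝔬.Dstar U)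
      (fun a b => BX * Real.exp (-(δ₃ * g.dist a b))))
    (hW : HasMaj bXH (cNorm R₀ H₀ 𝔬.blk hG.lenle 1) (𝔬.Dv U ∘ₗ Gp U ∘ₗ 𝔬.R U ∘ₗ 𝔬.Dvstar U)
      (fun a b => BW * Real.exp (-(δ₃ * g.dist a b))))
    (hI : Identities 𝔬 U) (h152 : Ids3152 𝔬 Gp U) :
    HasMajorantHom (g := toB6 g R₀ H₀) 𝔬.blkY 𝔬.blk (𝔬.GG U ∘ₗ 𝔬.Dstar U)
      (fun a b => (B₀ * (1 - θ * c)⁻¹ + bXH.κ * BW * BX * c +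
        B₃ * (1 - θ * c)⁻¹ * (B₃ * (B₃ * (B₀ * (1 - θ * c)⁻¹) * c) * c) * c) * g.len a *
        Real.exp (-(ρ' * g.dist a b))) := by
  have hinv : 0 ≤ (1 - θ * c)⁻¹ := inv_nonneg.mpr (by linarith)
  have hA₁ : 0 ≤ B₀ * (1 - θ * c)⁻¹ := mul_nonneg hB₀ hinv
  have hA₃ : 0 ≤ B₃ * (1 - θ * c)⁻¹ := mul_nonneg hB₃ hinv
  have hfix1 := fix_of_inverses hI.invG0' hI.invG1
  have hρ0 : 0 ≤ ρ := by linarith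
  have htri : Triangle254 (toB6 g R₀ H₀) := fun a b c => hG.tri a b c
  -- (a) G₁∇* : Y⁰ → 𝔠⁽¹⁾ from Theorem 3.3 (3.42)₃ for G₀ and the step
  have h0 : HasMaj (BlockNorm.ofBlocks (toB6 g R₀ H₀) 𝔬.blkY) (BlockNorm.ofBlocks (toB6 g R₀ H₀) 𝔬.blk)
      (𝔬.G0 U ∘ₗ 𝔬.Dstar U) (fun a b => B₀ * g.len a * Real.exp (-(δ₀ * g.dist a b))) :=
    hasMaj_of_hasMajorantHom (G := toB6 g R₀ H₀) 𝔬.blkY 𝔬.blk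
      (fun a b => mul_nonneg (mul_nonneg hB₀ (hG.lenle a)) (Real.exp_nonneg _)) he2
  have hS : HasMaj (cNorm R₀ H₀ 𝔬.blkY hG.lenle 0) (cNorm R₀ H₀ 𝔬.blk hG.lenle 1) (𝔬.G0 U ∘ₗ 𝔬.Dstar U)
      (fun a b => B₀ * Real.exp (-(δ₀ * g.dist a b))) := by
    refine (hasMaj_cNorm_of_hasMaj hG 1 0 h0).mono fun y y' => le_of_eq ?_
    have hy : g.len y ≠ 0 := (hG.lenpos y).ne'
    simp only [wt, pow_zero, pow_one, mul_one]
    rw [mul_assoc B₀, mul_comm (g.len y), ← mul_assoc B₀, mul_assoc, mul_inv_cancel₀ hy, mul_one]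
  have hG1 := hasMaj_right_of_step hG hrow hθ hB₀ hρ0 hρS hρδ hK hS hfix1 hq
  -- (b) G₁Q* : Z^{len·w} → 𝔠⁽¹⁾
  have hGQ := hasMaj_right_of_step_weight hG (wZlen_pos hG hwZ) hrow hθ hB₃ hρ0 hρ₃ hρδ hK hgQs1 hfix1 hq
  -- (c) QG₁∇* : Y⁰ → Z¹, rate ρ′ + 2σ
  have hQG : HasMaj (cNorm R₀ H₀ 𝔬.blkY hG.lenle 0) (cNorm R₀ H₀ 𝔬.blkZ hG.lenle 1) (𝔬.Q U ∘ₗ (𝔬.G1 U ∘ₗ 𝔬.Dstar U))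
      (fun a b => (cNorm R₀ H₀ 𝔬.blk hG.lenle 1 (X := X)).κ * B₃ * (B₀ * (1 - θ * c)⁻¹) * c *
        Real.exp (-((ρ' + 2 * σ) * g.dist a b))) :=
    hasMaj_comp_exp htri hG.dnn hrow hB₃ hA₁ (by linarith) (by linarith) (by linarith) hq1 hG1
  simp only [cNorm_κ, one_mul] at hQG
  -- all letters at the rate ρ′ + 2σ; the middle term is (D·G′·R·D*) ∘ (G₁∇*) through `bXH`
  have hδ₁ : ρ' + 2 * σ ≤ ρ := by linarith
  have hδ₃ : ρ' + 2 * σ ≤ δ₃ := by linarith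
  have h := hasMaj_frakG_classes (bA := cNorm R₀ H₀ 𝔬.blkY hG.lenle 0) (bC := cNorm R₀ H₀ 𝔬.blk hG.lenle 1)
    (bP := bXH) (bQ₁ := cNorm R₀ H₀ 𝔬.blkZ hG.lenle 1)
    (bQ₂ := weightNorm (BlockNorm.ofBlocks (toB6 g R₀ H₀) 𝔬.blkZ) (fun y => g.len y * wZ y) fun y => (wZlen_pos hG hwZ y).le)
    htri hG.dnn hrow hA₁ hBW hBX hA₃ hB₃ (mul_nonneg (mul_nonneg hB₃ hA₁) hc) hρ' hσ le_rfl
    (hG1.of_rate_le hG.dnn hA₁ hδ₁) (hW.of_rate_le hG.dnn hBW hδ₃) (hXH.of_rate_le hG.dnn hBX hδ₃)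
    (hGQ.of_rate_le hG.dnn hA₃ hδ₁) (hc1_1.of_rate_le hG.dnn hB₃ hδ₃) (hQG.of_rate_le hG.dnn
      (mul_nonneg (mul_nonneg hB₃ hA₁) hc) le_rfl)
  rw [← GG_comp_Dstar_eq_3152 hI h152 (𝔬.Dstar U)] at h
  simp only [cNorm_κ, weightNorm_ofBlocks_κ, one_mul] at h
  have hC0 : 0 ≤ (B₀ * (1 - θ * c)⁻¹ + bXH.κ * BW * BX * c +
        B₃ * (1 - θ * c)⁻¹ * (B₃ * (B₃ * (B₀ * (1 - θ * c)⁻¹) * c) * c) * c) :=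
    add_nonneg (add_nonneg hA₁ (mul_nonneg (mul_nonneg (mul_nonneg bXH.κ_nonneg hBW) hBX) hc))
      (mul_nonneg (mul_nonneg hA₃ (mul_nonneg (mul_nonneg hB₃ (mul_nonneg (mul_nonneg hB₃ hA₁) hc)) hc)) hc)
  have h2 : HasMaj (cNorm R₀ H₀ 𝔬.blkY hG.lenle 0) (cNorm R₀ H₀ 𝔬.blk hG.lenle 1) (𝔬.GG U ∘ₗ 𝔬.Dstar U)
      (fun a b => (B₀ * (1 - θ * c)⁻¹ + bXH.κ * BW * BX * c +
        B₃ * (1 - θ * c)⁻¹ * (B₃ * (B₃ * (B₀ * (1 - θ * c)⁻¹) * c) * c) * c) *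
        Real.exp (-(ρ' * g.dist a b))) :=
    h.mono fun a b => le_of_eq rfl
  have h' := hasMajorantHom_of_hasMaj_cNorm hG (fun a b => mul_nonneg hC0 (Real.exp_nonneg _)) h2
  refine hasMajorantHom_mono (g := toB6 g R₀ H₀) 𝔬.blkY 𝔬.blk h' fun a b => le_of_eq ?_
  simp only [wt, pow_zero, pow_one, inv_one, mul_one]
  ring

end OneMember

end

end Literature.MathematicalPhysics.QuantumFieldTheory.Balaban1983to89.B9Thm313WholeEntry2HolderCut
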